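import Summits.CriticalPhenomena.PercolationContinuityZ3.Theorems.Transplant.SkelNegBParamsSlotsRS
import Summits.CriticalPhenomena.PercolationContinuityZ3.Theorems.Transplant.SkelPhiStepINegO
import HarnessLib

/-!
# N1 params, chain of record `NegB`, part RootK: THE ZONE LIES IN THE KIT PAIR'S PRISM — p3-g9's root-residue hypothesis
# `hΛRg : ∀ c, O.merged.Λ c M_u ⊆ KS.RgK G t O.merged mk φK c` DISCHARGED at `AtQO` of the S1 choices of record

The zone of record is the fat prism `Λ c M_u = cylBall c M_u (ψ M_u)` (`FactsO.seed`); the kit prism is `pgramPrismFin φK c n_kit h_kit (3ℓ_kit) R_K` with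
`R_K = ψ(pgScale n_kit h_kit 3ℓ_kit)`, `φK = oriφ Φ.φ o_K`.  Fat balls and planar boxes are orientation-free, `M_u ≤ n_kit`, `|h_kit| ≤ 10·n_kit` (kit clause) and
`11·M_u ≤ 3ℓ_kit` (`ℓ_kit ≥ 24M_u + 64`) put the zone square inside the parallelogram `C(n_kit, h_kit, 3ℓ_kit)`, and `ψ` is monotone.

builds on p205010 (kernel theorem, internal audit signed; external expert review pending) — nothing in this file uses p205010; NOTHING is claimed about
the node `SamePDropOfSkeletonNeg₁` (OPEN).
Lane `prim-bschramm-*`, seat `prim-bschramm-stmt` (gen 14); helper file (`--supports stmt-CriticalPhenomena-4575 --as helper`); ledger HOME/prim-bschramm-stmt/NEG-PARAMS.md v0.13.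
* §1 generic: `cylBall_oriφ`, **`cyl_subset_pgramCyl_of`** (`M ≤ n`, `|h| ≤ 10n`, `11M ≤ 3ℓ` ⇒ `cyl c M ⊆ pgramCyl c n h (3ℓ)`),
  **`fatSeq_subset_pgramPrismFin`**;
* §2 **`KS.hΛRg_of_atQOS`** (p3-g9's `hΛRg` of `rootOblTWAt_negBS_x/_y`, every kit index `mk`).
[cite: KozmaNitzan2024, §4 p. 16 (Lemma 9), p. 28] [cite: MartineauTassion2017, §3.2 (A ⊆ C(n,h,ℓ_B))]
-/

noncomputable section

open scoped Classical

namespace Summit.CriticalPhenomena.PercolationContinuityZ3.Theorems.Transplant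

namespace Skelφ

open Literature.Probability.Percolation Literature.Probability.LatticeModels SimpleGraph
open Literature.Barriers.CriticalPhenomena (graphBall)

variable {V : Type} {G : SimpleGraph V} [G.LocallyFinite] {φ : V → Site 2}

/-! ## §1 The zone square inside a parallelogram prism, any orientation -/

/-- Fat balls are orientation-free. [folklore] -/
theorem cylBall_oriφ (b : Bool) (t : V) (ℓ R : ℕ) : cylBall G (oriφ φ b) t ℓ R = cylBall G φ t ℓ R := by
  cases b
  · rw [oriφ_false]; exact cylBall_trφ t ℓ R
  · rw [oriφ_true]

omit [G.LocallyFinite] in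
/-- **The zone square lies in `C(n, h, 3ℓ)`**: `M ≤ n`, `|h| ≤ 10·n`, `11·M ≤ 3·ℓ` give `|α| ≤ n` and `|β′| ≤ n·M + |h|·M ≤ 11·n·M ≤ n·3ℓ`.
[cite: MartineauTassion2017, §3.2 (A ⊆ C(n,h,ℓ_B))] -/
theorem cyl_subset_pgramCyl_of {c : V} {M n : ℕ} {h : ℤ} {ℓ : ℕ} (hMn : M ≤ n) (hh : h.natAbs ≤ 10 * n) (hℓ : 11 * M ≤ 3 * ℓ) :
    cyl φ c M ⊆ pgramCyl φ c n h (3 * ℓ) := by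
  intro w hw
  rw [mem_cyl, mem_box] at hw
  have h0' := hw 0; have h1' := hw 1
  simp only [Pi.sub_apply] at h0' h1'
  have h0 : |φ w 0 - φ c 0| ≤ (M : ℤ) := abs_le.2 ⟨by omega, by omega⟩
  have h1 : |φ w 1 - φ c 1| ≤ (M : ℤ) := abs_le.2 ⟨by omega, by omega⟩
  have hh' : |h| ≤ 10 * (n : ℤ) := by rw [← Int.natCast_natAbs]; exact_mod_cast hh
  have hℓ' : 11 * (M : ℤ) ≤ 3 * (ℓ : ℤ) := by exact_mod_cast hℓ
  have hMn' : (M : ℤ) ≤ n := by exact_mod_cast hMn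
  rw [mem_pgramCyl, relCoord_apply, shearCoord_apply]
  refine ⟨le_trans h0 hMn', ?_⟩
  have hn0 : (0 : ℤ) ≤ n := by positivity
  calc |(n : ℤ) * (φ w 1 - φ c 1) - h * (φ w 0 - φ c 0)| ≤ |(n : ℤ) * (φ w 1 - φ c 1)| + |h * (φ w 0 - φ c 0)| := abs_sub _ _
    _ = (n : ℤ) * |φ w 1 - φ c 1| + |h| * |φ w 0 - φ c 0| := by rw [abs_mul, abs_mul, Nat.abs_cast]
    _ ≤ (n : ℤ) * M + |h| * M := add_le_add (mul_le_mul_of_nonneg_left h1 hn0) (mul_le_mul_of_nonneg_left h0 (abs_nonneg _))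
    _ ≤ (n : ℤ) * M + 10 * n * M := by
        have hM0 : (0 : ℤ) ≤ M := by positivity
        nlinarith
    _ = (n : ℤ) * (11 * M) := by ring
    _ ≤ (n : ℤ) * ((3 * ℓ : ℕ) : ℤ) := by push_cast; exact mul_le_mul_of_nonneg_left hℓ' hn0

/-- **The fat prism `Λ^fat_M(c)` lies in the fat parallelogram `pgramPrismFin (oriφ φ b) c n h (3ℓ) R`** once `M ≤ n`, `|h| ≤ 10n`, `11M ≤ 3ℓ` and `ψ M ≤ R`.
[cite: KozmaNitzan2024, §4 p. 16 (Lemma 9)] [cite: MartineauTassion2017, §3.2] -/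
theorem fatSeq_subset_pgramPrismFin [Countable V] {types : Finset V} (hfr : Frames G φ types) {p : unitInterval} (hC : CylSubcritical G φ types p) (b : Bool)
    {c : V} {M n : ℕ} {h : ℤ} {ℓ R : ℕ} (hMn : M ≤ n) (hh : h.natAbs ≤ 10 * n) (hℓ : 11 * M ≤ 3 * ℓ) (hR : fatRadius hfr hC M ≤ R) :
    fatSeq hfr hC c M ⊆ pgramPrismFin G (oriφ φ b) c n h (3 * ℓ) R := by
  intro w hw
  rw [mem_fatSeq_iff] at hw
  rw [mem_pgramPrismFin, mem_pgramPrism]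
  refine ⟨?_, ?_⟩
  · rw [cylBall_oriφ]
    exact cylBall_mono G φ c (le_trans hMn (le_max_left _ _)) hR hw
  · have hw' : w ∈ cyl (oriφ φ b) c M := by rw [cyl_oriφ]; exact cylBall_subset_cyl G φ c M _ hw
    exact cyl_subset_pgramCyl_of hMn hh hℓ hw'

end Skelφ

namespace PlanarSkeletonNeg

namespace NegB

open MeasureTheory Literature.Probability.Percolation Literature.Probability.LatticeModels SimpleGraph
open SkelConc (Consts)
open Skelφ (oriφ)
open Skelφ.StepI (DataN OutO)
open Neg

namespace KS

/-! ## §2 The zone in the kit prism, at `AtQO` of the S1 choices -/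

section AtQ

variable {κ : Consts} {V : Type} [DecidableEq V] [Countable V] {G : SimpleGraph V} [G.LocallyFinite] {Φ : PlanarSkeletonNeg G} {t : V} {p : unitInterval}
  {hC : Φ.CylSubcritical p} {gv fv : Neg.FSlot} {Pv : PSlot} {Sv : SSlot} {O : OutO V} {q : unitInterval}

/-- **`hΛRg`**: at `AtQO`, for every kit index `mk` and every centre `c`, the zone `Λ c M_u` lies in the kit pair's prism `RgK … mk φK c`.
[cite: KozmaNitzan2024, §4 p. 28 ((32): the zone inside the kit region)] -/
theorem hΛRg_of_atQOS (mk : ℕ) (hAt : (choiceAtOS κ Φ t p gv fv Sv hC Pv).AtQO O q) :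
    ∀ c, O.merged.Λ c (Mu O.merged) ⊆ RgK G t O.merged mk (φK Φ t O.D O.DT O.ori mk) c := by
  intro c
  have hF := (factsO_of_atQOS hAt).1
  obtain ⟨-, -, -, hReq, hΛeq⟩ := hF.seed
  obtain ⟨hE, hh⟩ := clauseK_of_atQOS mk hAt
  have hℓ := ℓKit_ge t O.merged mk _ hE
  have hMu : Mu O.merged ≤ nKit O.merged mk := by have := (nKit_facts O.merged mk).2.2.2.1; omega
  have hscale : Mu O.merged ≤ O.merged.scale t (MK O.merged mk) (nKit O.merged mk) := le_trans hMu (le_max_left _ _)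
  have hR : Skelφ.fatRadius Φ.frame hC (Mu O.merged) ≤ RK t O.merged mk := by
    unfold RK; rw [hReq]; exact Skelφ.fatRadius_mono Φ.frame hC hscale
  rw [hΛeq]
  exact Skelφ.fatSeq_subset_pgramPrismFin Φ.frame hC _ hMu hh (by omega) hR

end AtQ

end KS

end NegB

end PlanarSkeletonNeg

end Summit.CriticalPhenomena.PercolationContinuityZ3.Theorems.Transplant
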